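import Summits.AtomisticToContinuum.BoseEinsteinCondensation.Theorems.BECInfDivCoherenceGridInfDivCoherenceCoherencePosIntegrable
import Summits.AtomisticToContinuum.BoseEinsteinCondensation.Theorems.BECConjugateDominationHardCoreExtensionUniformTruncationGapOfSimple
import Summits.AtomisticToContinuum.BoseEinsteinCondensation.Theorems.BECConjugateDominationHardCoreExtensionMaxFormSimpleOfPositive
import HarnessLib

/-!
# Crux `GridInfDivCoherence` (stmt-AtomisticToContinuum-9114), line `registered`: the fixed-box engine for the
# non-integrable class — coherence positivity of near-minimisers from a simple ground state positive on a free region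

For NON-INTEGRABLE pair profiles (hard cores, `⊤`-shells) the form domain with `W ∈ L¹` is not available, so the
fixed-box step of `…CoherencePosIntegrable.lean` is rebuilt on the maximal form through the FREE embedding `ι₀` of trial
states (`PeriodicFormDomain.lean`, profile `0`), for every repulsive finite-range `v` (namespace `CoherencePosHC`):
`exists_groundState_limit`, `exists_slack_near_ray` (Rellich through the free form domain + lower semicontinuity along
the truncation levels: if the ground-state class is a ray `ℂ f`, near-minimisers have `ι₀Ψ` close to `ℂ f`);
`re_inner_translate_pos_of_pos_on` (`f = |f|` a.e. positive on `U` and `U ∩ (U − s)` non-null ⇒ `re⟪τ_s f, f⟫ > 0`);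
`exists_free_add_single_free`, `volume_free_inter_pos` (the dilute free region meets each single-particle translate in
an open set); `coherencePos_of_ray` (floor by continuity of translation on `L²` and compactness; transfer by
`|re⟪τa,a⟫ − re⟪τb,b⟫| ≤ ‖a−b‖(‖a‖+‖b‖)`), exported in closed form as the registered stub `stub_coherencePosEngine`;
classes assembled in `…CoherencePosNonintegrable.lean`. Refs: Reed–Simon IV Thms XIII.44, XIII.64; Faris–Simon 1975. -/

noncomputable section

namespace Summit.AtomisticToContinuum.BoseEinsteinCondensation.Theorems

open MeasureTheory Filter Literature.MathematicalPhysics.QuantumManyBody Literature.MathematicalPhysics.QuantumManyBody.BoseGas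
  Literature.Analysis.FunctionSpaces
  Summit.AtomisticToContinuum.BoseEinsteinCondensation.Cruxes.HardCoreExtension.ThirdLawCurrentFloor
  Summit.AtomisticToContinuum.BoseEinsteinCondensation.Cruxes.HardCoreExtension.ThirdLawCurrentFloorAlt
  Summit.AtomisticToContinuum.BoseEinsteinCondensation.Cruxes.StaticResponseBound.UvThomsonForceWave
open scoped ENNReal NNReal ComplexConjugate InnerProductSpace Topology

-- Haar probability measure on `ℝ/ℤ`, as in `PeriodicFormDomain.lean` and the sibling landed files.
attribute [local instance] formDomain_measureSpace formDomain_isProbabilityMeasure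
  formDomain_isProbabilityMeasure_pi comparison_isAddHaarMeasure comparison_isAddRightInvariant

namespace CoherencePosHC

variable {N : ℕ} {L : ℝ} {v : ℝ → ℝ≥0∞}

/-- Local notation for the Hilbert space `L²((ℝ/ℤ)^{3N})`. -/
local notation "L2T " N':max => Lp ℂ 2 (volume : Measure (UnitAddTorus (Fin N' × Fin 3)))

/-- Local notation: the translation `(τ_s g)(t) = g(t + s)` on `L²((ℝ/ℤ)^{3N})` (a linear isometry). -/
local notation "τ[" s "]" =>
  Lp.compMeasurePreservingₗᵢ ℂ (fun t => t + s) (measurePreserving_add_right volume s)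

set_option quotPrecheck false in
/-- Local notation: the FREE embedding `ι₀Ψ ∈ L²((ℝ/ℤ)^{3N})` of a periodic trial state (auxiliary profile `0`). -/
local notation "ι₀[" hL "," Ψ "]" =>
  formEmbed hL measurable_zeroProfile (lintegral_periodicInteraction_zero_ne_top _ _)
    ⟨graphEmbed hL measurable_zeroProfile (lintegral_periodicInteraction_zero_ne_top _ _)
      ⟨PeriodicTrialState.ψ Ψ, PeriodicTrialState.mem_periodicCore Ψ⟩, graphEmbed_mem_formDomain _ _ _ _⟩

/-! ### Geometry: a free configuration that stays free when one particle is moved -/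

/-- A real number farther than `β` from every integer has quotient norm `> β` in `ℝ/ℤ`. [folklore] -/
theorem lt_norm_coe_of_lt_of_lt {β y : ℝ} (h1 : β < y) (h2 : y < 1 - β) : β < ‖((y : ℝ) : UnitAddCircle)‖ := by
  rw [UnitAddCircle.norm_eq]
  rcases le_or_gt (round y) 0 with h | h
  · have : ((round y : ℤ) : ℝ) ≤ 0 := by exact_mod_cast h
    exact lt_abs.2 (Or.inl (by linarith))
  · have : (1 : ℝ) ≤ ((round y : ℤ) : ℝ) := by exact_mod_cast h
    exact lt_abs.2 (Or.inr (by linarith))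

/-- One pair coordinate bounds the pair distance from below. [folklore] -/
theorem lt_pairDist_of_lt_norm {β : ℝ} {i j : Fin N} {t : UnitAddTorus (Fin N × Fin 3)} (k : Fin 3)
    (h : β < ‖t (i, k) - t (j, k)‖) : β < Torus.pairDist i j t := by
  calc β < ‖t (i, k) - t (j, k)‖ := h
    _ = Real.sqrt (‖t (i, k) - t (j, k)‖ ^ 2) := (Real.sqrt_sq (norm_nonneg _)).symm
    _ ≤ Torus.pairDist i j t := Real.sqrt_le_sqrt (Finset.single_le_sum
        (f := fun k => ‖t (i, k) - t (j, k)‖ ^ 2) (fun _ _ => sq_nonneg _) (Finset.mem_univ k))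

/-- **A free configuration that stays free when one particle is moved** (grid-and-slab on the unit torus): for
`5 ≤ K`, `N ≤ K³`, `3Kβ < 1`, particle `i`, shift `u`, some `t` has all pair distances of `t` AND of `t + (u on i)`
above `β` (particles on distinct nodes of `(ℤ/3K)³ ∩ [0,1/3)³`, the first coordinate of `i` in a slab). [folklore] -/
theorem exists_free_add_single_free {K : ℕ} (hK : 5 ≤ K) (hNK : N ≤ K ^ 3) {β : ℝ}
    (hβ : 3 * K * β < 1) (i : Fin N) (u : UnitAddTorus (Fin 3)) :
    ∃ t : UnitAddTorus (Fin N × Fin 3),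
      (∀ i' j' : Fin N, i' ≠ j' → β < Torus.pairDist i' j' t) ∧
      (∀ i' j' : Fin N, i' ≠ j' → β < Torus.pairDist i' j'
        (t + fun p : Fin N × Fin 3 => (Pi.single i u : Fin N → UnitAddTorus (Fin 3)) p.1 p.2)) := by
  classical
  have hK3 : (0 : ℝ) < 3 * K := by positivity
  have hβK : β < 1 / (3 * K) := by rw [lt_div_iff₀ hK3]; linarith
  have hβ15 : β < 1 / 15 :=
    hβK.trans_le (one_div_le_one_div_of_le (by norm_num) (by exact_mod_cast (show 15 ≤ 3 * K by omega)))
  -- reals in the window `(1/15, 9/10] + ℤ` have norm `> β`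
  have hwin : ∀ (y : ℝ) (n : ℤ), 1 / 15 < y + n → y + n ≤ 9 / 10 → β < ‖((y : ℝ) : UnitAddCircle)‖ := by
    intro y n h1 h2
    have hy : ((y : ℝ) : UnitAddCircle) = (((y + n : ℝ)) : UnitAddCircle) := by
      rw [AddCircle.coe_add, eq_comm, add_eq_left, AddCircle.coe_eq_zero_iff]
      exact ⟨n, by simp⟩
    rw [hy]
    exact lt_norm_coe_of_lt_of_lt (by linarith) (by linarith)
  -- grid coordinates lie in `[0, 1/3)`, and two distinct ones are farther than `β` apart on the circle
  have hgrid0 : ∀ m : Fin K, (0 : ℝ) ≤ (m : ℕ) / (3 * K) := fun m => by positivity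
  have hgrid1 : ∀ m : Fin K, ((m : ℕ) : ℝ) / (3 * K) < 1 / 3 := fun m => by
    rw [div_lt_iff₀ hK3]
    have : ((m : ℕ) : ℝ) + 1 ≤ K := by exact_mod_cast m.is_lt
    linarith
  have hgridsep : ∀ m m' : Fin K, m ≠ m' →
      β < ‖((((m : ℕ) : ℝ) / (3 * K) : ℝ) : UnitAddCircle) - ((((m' : ℕ) : ℝ) / (3 * K) : ℝ) : UnitAddCircle)‖ := by
    suffices h : ∀ m m' : Fin K, (m' : ℕ) < (m : ℕ) →
        β < ‖((((m : ℕ) : ℝ) / (3 * K) : ℝ) : UnitAddCircle) - ((((m' : ℕ) : ℝ) / (3 * K) : ℝ) : UnitAddCircle)‖ by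
      intro m m' hne
      rcases lt_or_gt_of_ne (Fin.val_injective.ne hne) with hlt | hlt
      · rw [← norm_neg, neg_sub]; exact h m' m hlt
      · exact h m m' hlt
    intro m m' hlt
    rw [← AddCircle.coe_sub, ← sub_div]
    have h1 : (1 : ℝ) ≤ (m : ℕ) - (m' : ℕ) := by
      have h'' : ((m' : ℕ) : ℝ) + 1 ≤ ((m : ℕ) : ℝ) := by exact_mod_cast hlt
      linarith
    refine lt_norm_coe_of_lt_of_lt (hβK.trans_le (div_le_div_of_nonneg_right h1 hK3.le)) ?_
    have := hgrid1 m
    have h0 := hgrid0 m'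
    rw [sub_div]
    linarith
  -- the grid labelling, the lift of the shift of the first coordinate, the slab position `x`, the configuration
  obtain ⟨g⟩ : Nonempty (Fin N ↪ (Fin 3 → Fin K)) := Function.Embedding.nonempty_of_card_le (by simpa using hNK)
  obtain ⟨ul, hul⟩ := QuotientAddGroup.mk_surjective (u 0)
  set w : ℝ := Int.fract ul with hw
  have hw0 : 0 ≤ w := Int.fract_nonneg ul
  have hw1 : w < 1 := Int.fract_lt_one ul
  set x : ℝ := if w ≤ 1 / 2 then 2 / 5 else 9 / 10 with hx
  have hx1 : w ≤ 1 / 2 → x = 2 / 5 := fun h => if_pos h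
  have hx2 : ¬ w ≤ 1 / 2 → x = 9 / 10 := fun h => if_neg h
  set c : Fin N × Fin 3 → ℝ := fun p => ((g p.1 p.2 : ℕ) : ℝ) / (3 * K) with hc
  set t : UnitAddTorus (Fin N × Fin 3) := fun p => if p = (i, 0) then ((x : ℝ) : UnitAddCircle)
    else ((c p : ℝ) : UnitAddCircle) with ht
  set s : UnitAddTorus (Fin N × Fin 3) :=
    fun p : Fin N × Fin 3 => (Pi.single i u : Fin N → UnitAddTorus (Fin 3)) p.1 p.2 with hs
  have hsj : ∀ (j : Fin N) (k : Fin 3), j ≠ i → s (j, k) = 0 := fun j k hj => by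
    simp only [hs, Pi.single_eq_of_ne hj, Pi.zero_apply]
  have hsi : ∀ k : Fin 3, s (i, k) = u k := fun k => by simp only [hs, Pi.single_eq_same]
  have htj : ∀ (j : Fin N) (k : Fin 3), j ≠ i → t (j, k) = ((c (j, k) : ℝ) : UnitAddCircle) := fun j k hj => by
    simp only [ht, Prod.mk.injEq, hj, false_and, if_false]
  have hti : t (i, 0) = ((x : ℝ) : UnitAddCircle) := by simp only [ht, if_true]
  -- a point on the grid off particle `i`, whose particle `i` is `β`-separated in the first coordinate, is free
  have hfar : ∀ (t' : UnitAddTorus (Fin N × Fin 3)), (∀ (j : Fin N) (k : Fin 3), j ≠ i →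
      t' (j, k) = ((c (j, k) : ℝ) : UnitAddCircle)) → (∀ j : Fin N, j ≠ i → β < ‖t' (i, 0) - t' (j, 0)‖) →
      ∀ i' j' : Fin N, i' ≠ j' → β < Torus.pairDist i' j' t' := by
    intro t' hgrid hslab i' j' hij
    by_cases h1 : i' = i
    · subst h1; exact lt_pairDist_of_lt_norm 0 (hslab j' (Ne.symm hij))
    by_cases h2 : j' = i
    · subst h2; rw [Torus.pairDist_comm]; exact lt_pairDist_of_lt_norm 0 (hslab i' hij)
    · obtain ⟨k, hk⟩ := Function.ne_iff.1 (fun h => hij (g.injective h) : g i' ≠ g j')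
      refine lt_pairDist_of_lt_norm k ?_
      rw [hgrid i' k h1, hgrid j' k h2]
      exact hgridsep _ _ hk
  -- `y + n ∈ [2/5, 9/10]` puts `y - (grid coordinate)` in the window modulo `ℤ`
  have hslab : ∀ (y : ℝ), (∃ n : ℤ, 2 / 5 ≤ y + n ∧ y + n ≤ 9 / 10) →
      ∀ j : Fin N, j ≠ i → β < ‖((y : ℝ) : UnitAddCircle) - ((c (j, 0) : ℝ) : UnitAddCircle)‖ := by
    rintro y ⟨n, h1, h2⟩ j hj
    rw [← AddCircle.coe_sub]
    have h0 := hgrid0 (g j 0)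
    have h3 := hgrid1 (g j 0)
    refine hwin (y - c (j, 0)) n ?_ ?_
    · show 1 / 15 < y - ((g j 0 : ℕ) : ℝ) / (3 * K) + n
      linarith
    · show y - ((g j 0 : ℕ) : ℝ) / (3 * K) + n ≤ 9 / 10
      linarith
  refine ⟨t, hfar t htj (fun j hj => ?_), hfar (t + s) (fun j k hj => ?_) (fun j hj => ?_)⟩
  · rw [hti, htj j 0 hj]
    refine hslab x ⟨0, ?_⟩ j hj
    rcases le_or_gt w (1 / 2) with hw2 | hw2
    · rw [hx1 hw2]; norm_num
    · rw [hx2 (not_le.2 hw2)]; norm_num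
  · rw [Pi.add_apply, hsj j k hj, add_zero, htj j k hj]
  · rw [Pi.add_apply, Pi.add_apply, hti, hsi, hsj j 0 hj, add_zero, htj j 0 hj, ← hul, ← AddCircle.coe_add]
    have hxu : ((x + ul : ℝ) : UnitAddCircle) = ((x + w : ℝ) : UnitAddCircle) := by
      rw [hw, eq_comm, ← sub_eq_zero, ← AddCircle.coe_sub, AddCircle.coe_eq_zero_iff]
      refine ⟨-⌊ul⌋, ?_⟩
      rw [Int.fract]
      simp only [zsmul_eq_mul, mul_one, Int.cast_neg]
      ring
    rw [hxu]
    rcases le_or_gt w (1 / 2) with hw2 | hw2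
    · refine hslab (x + w) ⟨0, ?_, ?_⟩ j hj <;> rw [hx1 hw2] <;> push_cast <;> linarith
    · refine hslab (x + w) ⟨-1, ?_, ?_⟩ j hj <;> rw [hx2 (not_le.2 hw2)] <;> push_cast <;> linarith

/-- **The dilute free region meets its single-particle translates in positive measure**: with `K` as above, the free
region `U = {t | ∀ i ≠ j, β < ρᵢⱼ(t)}` is open and `U ∩ (U - (u on particle i))` is non-empty, hence Haar-positive. [folklore] -/
theorem volume_free_inter_pos {K : ℕ} (hK : 5 ≤ K) (hNK : N ≤ K ^ 3) {β : ℝ} (hβ : 3 * K * β < 1)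
    (i : Fin N) (u : UnitAddTorus (Fin 3)) :
    0 < (volume : Measure (UnitAddTorus (Fin N × Fin 3)))
      ({t : UnitAddTorus (Fin N × Fin 3) | ∀ i' j' : Fin N, i' ≠ j' → β < Torus.pairDist i' j' t} ∩
        (fun t => t + fun p : Fin N × Fin 3 => (Pi.single i u : Fin N → UnitAddTorus (Fin 3)) p.1 p.2) ⁻¹'
          {t : UnitAddTorus (Fin N × Fin 3) | ∀ i' j' : Fin N, i' ≠ j' → β < Torus.pairDist i' j' t}) := by
  haveI : (volume : Measure UnitAddCircle).IsOpenPosMeasure :=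
    inferInstanceAs ((AddCircle.haarAddCircle : Measure UnitAddCircle).IsOpenPosMeasure)
  haveI : (volume : Measure (UnitAddTorus (Fin N × Fin 3))).IsOpenPosMeasure := Measure.pi.isOpenPosMeasure _
  have hopen : IsOpen {t : UnitAddTorus (Fin N × Fin 3) | ∀ i' j' : Fin N, i' ≠ j' → β < Torus.pairDist i' j' t} := by
    have hset : {t : UnitAddTorus (Fin N × Fin 3) | ∀ i' j' : Fin N, i' ≠ j' → β < Torus.pairDist i' j' t} =
        ⋂ i' : Fin N, ⋂ j' : Fin N, {t | i' ≠ j' → β < Torus.pairDist i' j' t} := by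
      ext t; simp only [Set.mem_setOf_eq, Set.mem_iInter]
    rw [hset]
    refine isOpen_iInter_of_finite fun i' => isOpen_iInter_of_finite fun j' => ?_
    by_cases h : i' = j'
    · simp [h]
    · simp only [ne_eq, h, not_false_eq_true, true_implies]
      exact isOpen_lt continuous_const (Torus.continuous_pairDist i' j')
  obtain ⟨t, ht, hts⟩ := exists_free_add_single_free hK hNK hβ i u
  exact (hopen.inter (hopen.preimage (continuous_id.add continuous_const))).measure_pos volume ⟨t, ht, hts⟩

/-! ### The coherence of a non-negative state positive on a set -/

/-- **Positivity of one coherence value.** If `f ∈ L²((ℝ/ℤ)^{3N})` is (a.e.) real non-negative and a.e. non-zero on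
`U`, and `U ∩ (U - s)` has positive measure, then `re⟪τ_s f, f⟫ = ∫ f(t+s) f(t) dt > 0`. [cite: ReedSimonIV1978, Thm XIII.44] -/
theorem re_inner_translate_pos_of_pos_on (f : L2T N)
    (hreal : (f : UnitAddTorus (Fin N × Fin 3) → ℂ) =ᵐ[volume]
      fun t => ((‖(f : UnitAddTorus (Fin N × Fin 3) → ℂ) t‖ : ℝ) : ℂ))
    {U : Set (UnitAddTorus (Fin N × Fin 3))}
    (hU : ∀ᵐ t ∂(volume : Measure (UnitAddTorus (Fin N × Fin 3))), t ∈ U → (f : UnitAddTorus (Fin N × Fin 3) → ℂ) t ≠ 0)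
    (s : UnitAddTorus (Fin N × Fin 3))
    (hs : 0 < (volume : Measure (UnitAddTorus (Fin N × Fin 3))) (U ∩ (fun t => t + s) ⁻¹' U)) :
    0 < (⟪(τ[s] f : L2T N), f⟫_ℂ).re := by
  have hqmp := (measurePreserving_add_right (volume : Measure (UnitAddTorus (Fin N × Fin 3))) s).quasiMeasurePreserving
  have hτreal : ((τ[s] f : L2T N) : UnitAddTorus (Fin N × Fin 3) → ℂ) =ᵐ[volume]
      fun t => ((‖(f : UnitAddTorus (Fin N × Fin 3) → ℂ) (t + s)‖ : ℝ) : ℂ) := by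
    filter_upwards [CoherencePosL2.coeFn_translate s f, hqmp.ae_eq_comp hreal] with t h1 h2
    simp only [Function.comp_apply] at h2
    rw [h1, h2, Complex.norm_real, norm_norm]
  have hτU : ∀ᵐ t ∂(volume : Measure (UnitAddTorus (Fin N × Fin 3))),
      t + s ∈ U → (f : UnitAddTorus (Fin N × Fin 3) → ℂ) (t + s) ≠ 0 := hqmp.ae hU
  rw [MeasureTheory.L2.inner_def, ← RCLike.re_to_complex, ← integral_re (L2.integrable_inner _ _)]
  refine (integral_pos_iff_support_of_nonneg_ae ?_ (L2.integrable_inner _ _).re).2 (hs.trans_le ?_)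
  · filter_upwards [hτreal, hreal] with t h1 h2
    rw [Pi.zero_apply, RCLike.inner_apply', h1, h2, Complex.conj_ofReal, ← Complex.ofReal_mul,
      RCLike.re_to_complex, Complex.ofReal_re]
    positivity
  · -- the support contains `U ∩ (U - s)` up to a null set
    refine measure_mono_ae ?_
    filter_upwards [hU, hτU, hτreal, hreal] with t h1 h2 h3 h4
    rintro ⟨htU, htsU⟩
    change RCLike.re ⟪((τ[s] f : L2T N) : UnitAddTorus (Fin N × Fin 3) → ℂ) t,
      (f : UnitAddTorus (Fin N × Fin 3) → ℂ) t⟫_ℂ ≠ 0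
    rw [RCLike.inner_apply', h3, h4, Complex.conj_ofReal, ← Complex.ofReal_mul, RCLike.re_to_complex, Complex.ofReal_re]
    exact mul_ne_zero (norm_ne_zero_iff.2 (h2 htsU)) (norm_ne_zero_iff.2 (h1 htU))

/-! ### Compactness: ground states as limits, and near-minimisers near the ray -/

/-- **Ground states as limits of near-minimisers** (`E₀ < ⊤`): trial states `Ψ_k` with `E_v[Ψ_k] ≤ E₀ + 1/(k+1)` have a
subsequence whose free-embedded classes converge in `L²((ℝ/ℤ)^{3N})` to a unit maximal-form ground state (Rellich through
the free form domain; lower semicontinuity along the truncation levels). [cite: ReedSimonIV1978, Thm XIII.64] -/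
theorem exists_groundState_limit (hv : IsRepulsiveFiniteRange v) (hL : 0 < L)
    (hE : periodicGroundStateEnergy v N L ≠ ⊤) (Ψ : ℕ → PeriodicTrialState N L)
    (hΨ : ∀ k, periodicEnergy v (Ψ k) ≤ periodicGroundStateEnergy v N L + ENNReal.ofReal (1 / ((k : ℝ) + 1))) :
    ∃ η : L2T N, η ∈ maxFormGroundStates v N L ∧ ‖η‖ = 1 ∧ ∃ φ : ℕ → ℕ, StrictMono φ ∧
      Tendsto (fun j => (ι₀[hL, Ψ (φ j)] : L2T N)) atTop (𝓝 η) := by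
  have hB : periodicGroundStateEnergy v N L + 1 ≠ ⊤ := ENNReal.add_ne_top.2 ⟨hE, ENNReal.one_ne_top⟩
  have hle : ∀ k n, periodicEnergy (truncPotential v n) (Ψ k) ≤
      periodicGroundStateEnergy v N L + ENNReal.ofReal (1 / ((k : ℝ) + 1)) :=
    fun k n => (periodicEnergy_truncPotential_le' v n _).trans (hΨ k)
  obtain ⟨η, φ, hφ, hconv, hnorm, hsymm, -⟩ := exists_limitProfile_of_seq hv.1 hL hB Ψ
    fun n => (hle n n).trans (add_le_add le_rfl (ofReal_one_div_add_one_le_one n))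
  refine ⟨η, ⟨hsymm, ?_⟩, hnorm, φ, hφ, hconv⟩
  rw [hnorm, one_pow, ENNReal.ofReal_one, mul_one]
  exact maxForm_le_of_tendsto_truncLevels hv hL (Ψ := fun j => Ψ (φ j)) (lev := φ) (fun j => hφ.le_apply)
    (tendsto_ofReal_one_div_add_one hφ) (fun j => hle (φ j) (φ j)) hconv

/-- **Near-minimisers are close to the ground-state ray.** If every maximal-form ground state is a multiple of `f`,
then for every `ε > 0` some `δ > 0` makes the free-embedded class of every `δ`-near-minimiser `ε`-close to `ℂ f`
(otherwise `1/(k+1)`-near-minimisers `ε`-far from `ℂ f` would have a ground-state limit). [cite: ReedSimonIV1978, Thm XIII.64] -/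
theorem exists_slack_near_ray (hv : IsRepulsiveFiniteRange v) (hL : 0 < L)
    (hE : periodicGroundStateEnergy v N L ≠ ⊤) {f : L2T N}
    (hray : ∀ ξ ∈ maxFormGroundStates v N L, ∃ c : ℂ, ξ = c • f) {ε : ℝ} (hε : 0 < ε) :
    ∃ δ : ℝ≥0∞, 0 < δ ∧ ∀ Ψ : PeriodicTrialState N L,
      periodicEnergy v Ψ ≤ periodicGroundStateEnergy v N L + δ → ∃ c : ℂ, ‖(ι₀[hL, Ψ] : L2T N) - c • f‖ < ε := by
  by_contra hcon
  push Not at hcon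
  choose Ψ hΨE hΨfar using fun k : ℕ =>
    hcon (ENNReal.ofReal (1 / ((k : ℝ) + 1))) (ENNReal.ofReal_pos.2 Nat.one_div_pos_of_nat)
  obtain ⟨η, hη, -, φ, -, hconv⟩ := exists_groundState_limit hv hL hE Ψ hΨE
  obtain ⟨c, hc⟩ := hray η hη
  obtain ⟨j, hj⟩ := (Metric.tendsto_nhds.1 hconv ε hε).exists
  rw [dist_eq_norm, hc] at hj
  exact (not_lt.2 (hΨfar (φ j) c)) hj

/-! ### The fixed-box transfer -/

/-- The torus shift of configuration space by `r` in particle `i` is the single-particle torus shift. [folklore] -/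
theorem toUnitTorusN_single (L : ℝ) (i : Fin N) (r : Space) :
    toUnitTorusN L (Pi.single i r : Config N) =
      fun p : Fin N × Fin 3 => (Pi.single i (toUnitTorus L r) : Fin N → UnitAddTorus (Fin 3)) p.1 p.2 := by
  funext p
  obtain ⟨j, k⟩ := p
  rw [toUnitTorusN_apply]
  by_cases h : j = i
  · subst h; simp only [Pi.single_eq_same]; rfl
  · simp only [Pi.single_eq_of_ne h, PiLp.zero_apply, zero_div, Pi.zero_apply, QuotientAddGroup.mk_zero]

/-- **Coherence positivity of near-minimisers at a fixed box from a positive simple ground state** (`E₀ < ⊤`, the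
ground-state class the ray of a unit `f = |f|` a.e. non-zero on `U` meeting its single-particle translates in positive
measure): the coherence of `f` is positive and continuous in the shift, hence `≥ g > 0`; `ι₀Ψ` is `g/8`-close to some
`c f`; `|re⟪τa,a⟫ − re⟪τb,b⟫| ≤ ‖a−b‖(‖a‖+‖b‖)`. [cite: ReedSimonIV1978, Thm XIII.44] -/
theorem coherencePos_of_ray (hv : IsRepulsiveFiniteRange v) (hL : 0 < L)
    (hE : periodicGroundStateEnergy v N L ≠ ⊤) {f : L2T N} (hf1 : ‖f‖ = 1) (hfabs : absLp f = f)
    (hray : ∀ ξ ∈ maxFormGroundStates v N L, ∃ c : ℂ, ξ = c • f)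
    {U : Set (UnitAddTorus (Fin N × Fin 3))}
    (hU : ∀ᵐ t ∂(volume : Measure (UnitAddTorus (Fin N × Fin 3))), t ∈ U → (f : UnitAddTorus (Fin N × Fin 3) → ℂ) t ≠ 0)
    (hgeo : ∀ (i : Fin N) (u : UnitAddTorus (Fin 3)), 0 < (volume : Measure (UnitAddTorus (Fin N × Fin 3)))
      (U ∩ (fun t => t + fun p : Fin N × Fin 3 => (Pi.single i u : Fin N → UnitAddTorus (Fin 3)) p.1 p.2) ⁻¹' U)) :
    ∃ δ : ℝ≥0∞, 0 < δ ∧ ∀ Ψ : PeriodicTrialState N L,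
      periodicEnergy v Ψ ≤ periodicGroundStateEnergy v N L + δ → ∀ (i : Fin N) (r : Space),
        0 < (∫ X in cellN N L, conj (Ψ.ψ (Function.update X i (X i + r))) * Ψ.ψ X).re := by
  rcases Nat.eq_zero_or_pos N with hN | hN
  · subst hN; exact ⟨1, one_pos, fun Ψ _ i => i.elim0⟩
  haveI : Nonempty (Fin N) := ⟨⟨0, hN⟩⟩
  have hreal : (f : UnitAddTorus (Fin N × Fin 3) → ℂ) =ᵐ[volume]
      fun t => ((‖(f : UnitAddTorus (Fin N × Fin 3) → ℂ) t‖ : ℝ) : ℂ) := by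
    have h := coeFn_absLp f
    rwa [hfabs] at h
  -- the floor of the coherence of `f` over all single-particle shifts
  set F : Fin N → UnitAddTorus (Fin 3) → ℝ := fun i u =>
    (⟪(τ[fun p : Fin N × Fin 3 => (Pi.single i u : Fin N → UnitAddTorus (Fin 3)) p.1 p.2] f : L2T N), f⟫_ℂ).re
    with hF
  have hFpos : ∀ i u, 0 < F i u := fun i u => re_inner_translate_pos_of_pos_on f hreal hU _ (hgeo i u)
  have hFcont : ∀ i, Continuous (F i) := by
    intro i
    have hsh : Continuous fun u : UnitAddTorus (Fin 3) =>
        (fun p : Fin N × Fin 3 => (Pi.single i u : Fin N → UnitAddTorus (Fin 3)) p.1 p.2) := by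
      refine continuous_pi fun p => ?_
      rcases eq_or_ne p.1 i with h | h
      · simp only [h, Pi.single_eq_same]; exact continuous_apply p.2
      · simp only [Pi.single_eq_of_ne h, Pi.zero_apply]; exact continuous_const
    exact Complex.continuous_re.comp (((CoherencePosL2.continuous_translate f).comp hsh).inner continuous_const)
  have hfl : ∀ i, ∃ g : ℝ, 0 < g ∧ ∀ u, g ≤ F i u := fun i => by
    obtain ⟨u₀, -, hmin⟩ := isCompact_univ.exists_isMinOn Set.univ_nonempty (hFcont i).continuousOn
    exact ⟨F i u₀, hFpos i u₀, fun u => hmin (Set.mem_univ u)⟩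
  choose g hg0 hg using hfl
  obtain ⟨i₀, -, hi₀⟩ := Finset.exists_min_image Finset.univ g Finset.univ_nonempty
  set g₁ : ℝ := min (g i₀) 1 with hg₁
  have hg₁0 : 0 < g₁ := lt_min (hg0 i₀) one_pos
  have hg₁1 : g₁ ≤ 1 := min_le_right _ _
  have hfloor : ∀ i u, g₁ ≤ F i u := fun i u => (min_le_left _ _).trans ((hi₀ i (Finset.mem_univ i)).trans (hg i u))
  -- the slack
  obtain ⟨δ, hδ, hnear⟩ := exists_slack_near_ray hv hL hE hray (by positivity : 0 < g₁ / 8)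
  refine ⟨δ, hδ, fun Ψ hΨ i r => ?_⟩
  obtain ⟨c, hc⟩ := hnear Ψ hΨ
  -- the cell coherence is a torus amplitude at a single-particle shift
  set u : UnitAddTorus (Fin 3) := toUnitTorus L r with hu
  have hdict := CoherencePosL2.inner_translate_formEmbed_trialState hL measurable_zeroProfile
    (lintegral_periodicInteraction_zero_ne_top N L) Ψ (Pi.single i r : Config N)
  simp_rw [update_eq_add_single]
  rw [← hdict, toUnitTorusN_single L i r]
  set eΨ : L2T N := ι₀[hL, Ψ] with heΨ
  have heΨ1 : ‖eΨ‖ = 1 := norm_formEmbed_graphEmbed_trialState hL _ _ Ψ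
  -- stability of the amplitude and the floor of `c • f`
  set T : L2T N →ₗᵢ[ℂ] L2T N :=
    (τ[fun p : Fin N × Fin 3 => (Pi.single i u : Fin N → UnitAddTorus (Fin 3)) p.1 p.2]) with hT
  have hstab := CoherencePosL2.abs_re_inner_map_sub_le T eΨ (c • f)
  have hcf : ‖c • f‖ = ‖c‖ := by rw [norm_smul, hf1, mul_one]
  have hsm : (⟪T (c • f), c • f⟫_ℂ).re = ‖c‖ ^ 2 * F i u := by
    rw [hF]
    simp only
    rw [map_smul, inner_smul_left, inner_smul_right, ← mul_assoc, Complex.conj_mul' c, ← Complex.ofReal_pow,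
      Complex.re_ofReal_mul]
  rw [heΨ1, hcf, hsm] at hstab
  have hcn : |1 - ‖c‖| ≤ ‖eΨ - c • f‖ := by
    have := abs_norm_sub_norm_le eΨ (c • f); rwa [heΨ1, hcf] at this
  set d : ℝ := ‖eΨ - c • f‖ with hdd
  have hd : d < g₁ / 8 := hc
  have hd0 : 0 ≤ d := norm_nonneg _
  have h1 : (1 - d) ^ 2 * g₁ ≤ ‖c‖ ^ 2 * F i u :=
    mul_le_mul (pow_le_pow_left₀ (by linarith) (by linarith [(abs_le.1 hcn).2]) 2) (hfloor i u) hg₁0.le (sq_nonneg _)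
  have h2 : d * (1 + ‖c‖) ≤ d * (2 + d) := mul_le_mul_of_nonneg_left (by linarith [(abs_le.1 hcn).1]) hd0
  have hA : (1 - d) ^ 2 * g₁ - d * (2 + d) ≤ (⟪T eΨ, eΨ⟫_ℂ).re := by linarith [(abs_le.1 hstab).1]
  have p1 : d * g₁ ≤ g₁ / 8 * g₁ := mul_le_mul_of_nonneg_right hd.le hg₁0.le
  have p2 : d * d ≤ d * (g₁ / 8) := mul_le_mul_of_nonneg_left hd.le hd0
  have p3 : 0 ≤ d ^ 2 * g₁ := by positivity
  have gg : g₁ * g₁ ≤ g₁ := mul_le_of_le_one_right hg₁0.le hg₁1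
  nlinarith [hA, p1, p2, p3, gg, hd, hg₁0, hg₁1, hd0]

end CoherencePosHC

/-- **Registered stub `stub_coherencePosEngine`** (line `registered`, crux stmt-AtomisticToContinuum-9114): the closed
form of `CoherencePosHC.coherencePos_of_ray` — a simple ground state `f = |f|` positive on a set meeting its
single-particle translates forces strictly positive coherence of all near-minimisers. [cite: ReedSimonIV1978, Thm XIII.44] -/
theorem stub_coherencePosEngine :
    ∀ (N : ℕ) (L : ℝ) (v : ℝ → ℝ≥0∞), IsRepulsiveFiniteRange v → 0 < L →
      periodicGroundStateEnergy v N L ≠ ⊤ →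
      ∀ f : Lp ℂ 2 (volume : Measure (UnitAddTorus (Fin N × Fin 3))), ‖f‖ = 1 → absLp f = f →
        (∀ ξ ∈ maxFormGroundStates v N L, ∃ c : ℂ, ξ = c • f) →
        ∀ U : Set (UnitAddTorus (Fin N × Fin 3)),
          (∀ᵐ t ∂(volume : Measure (UnitAddTorus (Fin N × Fin 3))), t ∈ U →
            (f : UnitAddTorus (Fin N × Fin 3) → ℂ) t ≠ 0) →
          (∀ (i : Fin N) (u : UnitAddTorus (Fin 3)), 0 < (volume : Measure (UnitAddTorus (Fin N × Fin 3)))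
            (U ∩ (fun t => t + fun p : Fin N × Fin 3 =>
              (Pi.single i u : Fin N → UnitAddTorus (Fin 3)) p.1 p.2) ⁻¹' U)) →
          ∃ δ : ℝ≥0∞, 0 < δ ∧ ∀ Ψ : PeriodicTrialState N L,
            periodicEnergy v Ψ ≤ periodicGroundStateEnergy v N L + δ → ∀ (i : Fin N) (r : Space),
              0 < (∫ X in cellN N L, conj (Ψ.ψ (Function.update X i (X i + r))) * Ψ.ψ X).re :=
  fun _ _ _ hv hL hE _ hf1 hfabs hray _ hU hgeo => CoherencePosHC.coherencePos_of_ray hv hL hE hf1 hfabs hray hU hgeo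

end Summit.AtomisticToContinuum.BoseEinsteinCondensation.Theorems

end
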